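import Summits.BirchSwinnertonDyer.BirchSwinnertonDyer.Theses.AdditiveKolyvaginRoad
import Summits.BirchSwinnertonDyer.BirchSwinnertonDyer.Theorems.AdditiveKolyvaginRoadManinFrameTransport
import Summits.BirchSwinnertonDyer.BirchSwinnertonDyer.Theorems.AdditiveKolyvaginRoadManinFrameFromDatum
import HarnessLib

/-! v3 (tenure g4, 2026-08-27T13:5xZ; catch by akr-p2 g6 13:48:35Z): both stubs now take the MODULARITY binder
`(hnf : exists_isNewformOf)` = conjunct 6 of `PublishedInputsAdditiveKoly`, fed by the composition from `hPub`. Without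
it a `ModularParametrizationData W₀ N` is not constructible in the tree at all (even the Cremona-range rung p534837
needs `hnf`), so the v2 stubs were unprovable AS REGISTERED independently of Manin — a statement defect, not
mathematics. Statements otherwise byte-identical to v2 (66a57f02c620); composition unchanged but for the two `hPub`
arguments. -/

/-! # Birth skeleton (BC3) for crux `ManinFrameResidueProper` (item stmt-BirchSwinnertonDyer-20483,
route AdditiveKolyvaginRoad, top-level since rev 10) — tenure planner bsd-wall-add g4, 2026-08-27.

LINE `birth` = "Manin-unit datum on SOME minimal member, by residue prime range, then transport":
the crux asks, on the PROPER Manin residue of the additive road (p ≥ 5 additive, `E[p]` irreducible,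
Edixhoven exception class, no `Iₙ*` member, every parametrisation of every minimal member at level
`N(W)` of degree divisible by `p`), for a Manin-good odd Heegner frame of `W`. By the LANDED transport
`ManinFrameTransport.exists_modularParametrizationData_not_dvd_of_partner` (prime-to-`p` isogeny
multiplier under Irr, JSW 2017 §7.4.1 / ARS 2006 Thm 2.6) and the LANDED frame construction
`ManinFrameFromDatum.exists_oddHeegnerFrame_of_exists_not_dvd` (Hoffstein–Luo field + Darmon 3.6),
it suffices that SOME globally minimal member `W₀ ∼ W` carry a parametrisation datum at level `N(W)`
with `p ∤ c(D₀)` — Manin's conjecture (`p`-part) for one member, in particular for the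
`X₀(N)`-optimal curve. The two stubs cut that statement by the residue's prime range, which is also
the cut of the literature: `p ∈ {5, 7}` (Edixhoven's method allows `5, 7 ∣ c`; every additive
Kodaira type) and `p ≥ 11` potentially-good-ORDINARY of type II/III/IV (`v_p Δ_min ≤ 4`; Edixhoven
1991 Thm 3: `p ∣ c` at most once — the stub says: not even once). Neither stub uses `r_an = 1`
(the Manin constant does not see the rank), so neither is the crux re-worded; the composition
`ManinFrameResidueProper_of` calls the two stubs by name and is otherwise a real proof over the two
landed theorems (no sorry of its own).
Honours: no `Disproof.lean` exists yet for this crux (none relevant). -/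

set_option autoImplicit false
set_option linter.dupNamespace false

noncomputable section

open scoped Classical

open WeierstrassCurve NumberField Literature.NumberTheory.EllipticCurves
  Literature.NumberTheory.EllipticCurves.ModularForms
  Literature.NumberTheory.EllipticCurves.Rank1Residual
  Literature.NumberTheory.DiophantineGeometry IsDedekindDomain Rat.HeightOneSpectrum
  Summit.BirchSwinnertonDyer.Rank1Residual Summit.BirchSwinnertonDyer.Rank1Residual.Additive
  Summit.BirchSwinnertonDyer.BirchSwinnertonDyer.Theses.AdditiveKolyvaginRoad

namespace Summit.BirchSwinnertonDyer.BirchSwinnertonDyer.Cruxes.ManinFrameResidueProper.Birth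

/-- **Stub S57 — Manin's `p`-part for SOME minimal member, `p ∈ {5, 7}`** (research): on the
residue at `p = 5, 7` (additive, `E[p]` irreducible, no `Iₙ*` member, every parametrisation of every
minimal member at level `N(W)` of degree divisible by `p`), some globally minimal `W₀ ∼ W` has a
parametrisation datum at level `N(W)` with `p ∤ c(D₀)`. Edixhoven's stable-reduction analysis leaves
exactly `5, 7` as possible odd prime divisors of `c` at additive primes; Cremona/ARS: `c₀ = 1` for
every optimal curve of conductor `< 5·10⁵`. [cite: EdixhovenManin1991, Thm. 3]
[cite: AgasheRibetStein2006, Thm. 2.6] [cite: CesnaviciusNeururerSaha2023, Thm. 1.2] -/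
theorem stub_memberManinUnit_fiveSeven
    (hnf : Literature.NumberTheory.EllipticCurves.ModularForms.exists_isNewformOf)
    (W : WeierstrassCurve ℚ) [W.IsElliptic] [W.IsGloballyMinimal] (p : ℕ) [Fact p.Prime]
    [NeZero (W.conductorNorm ℤ)] (hp5 : 5 ≤ p) (hp11 : p < 11) (hadd : Addv W p) (hirr : Irr W p)
    (hres : ((p < 11 ∨ ∃ (W' : WeierstrassCurve ℚ) (_ : W'.IsElliptic) (_ : W'.IsGloballyMinimal),
          IsIsogenous W W' ∧ TypeGOrd W' p ∧ padicValInt p W'.minimalDiscriminantInt ≤ 4) ∧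
        (∃ (W' : WeierstrassCurve ℚ) (_ : W'.IsElliptic) (_ : W'.IsGloballyMinimal),
          IsIsogenous W W' ∧ ∀ (v : HeightOneSpectrum ℤ) (n : ℕ), natGenerator v = p →
            W'.kodairaSymbolAt v ≠ KodairaSymbol.Istar n)))
    (hall : (∀ (W' : WeierstrassCurve ℚ) [W'.IsElliptic] [W'.IsGloballyMinimal]
          (D' : ModularParametrizationData W' (W.conductorNorm ℤ)),
          IsIsogenous W W' → p ∣ D'.modularDegree)) :
    ∃ (W₀ : WeierstrassCurve ℚ) (_ : W₀.IsElliptic) (_ : W₀.IsGloballyMinimal)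
        (D₀ : ModularParametrizationData W₀ (W.conductorNorm ℤ)),
        IsIsogenous W W₀ ∧ ¬ (p : ℤ) ∣ D₀.c := by
  sorry

/-- **Stub S11 — Manin's `p`-part for SOME minimal member, `p ≥ 11` potentially-good-ordinary of
type II/III/IV** (research): on the residue at `p ≥ 11` (additive, `E[p]` irreducible, some minimal
member potentially good ORDINARY with `v_p(Δ_min) ≤ 4`, no `Iₙ*` member, all degrees at level `N(W)`
divisible by `p`), some globally minimal `W₀ ∼ W` has a parametrisation datum at level `N(W)` with
`p ∤ c(D₀)`. Edixhoven 1991 Thm 3 gives `v_p(c) ≤ 1` here ("at most once"); the stub is "never".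
[cite: EdixhovenManin1991, Thm. 3] [cite: AgasheRibetStein2006, Thm. 2.6]
[cite: Cesnavicius2018, Thm. 1.2] -/
theorem stub_memberManinUnit_ordinary
    (hnf : Literature.NumberTheory.EllipticCurves.ModularForms.exists_isNewformOf)
    (W : WeierstrassCurve ℚ) [W.IsElliptic] [W.IsGloballyMinimal] (p : ℕ) [Fact p.Prime]
    [NeZero (W.conductorNorm ℤ)] (hp11 : 11 ≤ p) (hadd : Addv W p) (hirr : Irr W p)
    (hres : ((p < 11 ∨ ∃ (W' : WeierstrassCurve ℚ) (_ : W'.IsElliptic) (_ : W'.IsGloballyMinimal),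
          IsIsogenous W W' ∧ TypeGOrd W' p ∧ padicValInt p W'.minimalDiscriminantInt ≤ 4) ∧
        (∃ (W' : WeierstrassCurve ℚ) (_ : W'.IsElliptic) (_ : W'.IsGloballyMinimal),
          IsIsogenous W W' ∧ ∀ (v : HeightOneSpectrum ℤ) (n : ℕ), natGenerator v = p →
            W'.kodairaSymbolAt v ≠ KodairaSymbol.Istar n)))
    (hall : (∀ (W' : WeierstrassCurve ℚ) [W'.IsElliptic] [W'.IsGloballyMinimal]
          (D' : ModularParametrizationData W' (W.conductorNorm ℤ)),
          IsIsogenous W W' → p ∣ D'.modularDegree)) :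
    ∃ (W₀ : WeierstrassCurve ℚ) (_ : W₀.IsElliptic) (_ : W₀.IsGloballyMinimal)
        (D₀ : ModularParametrizationData W₀ (W.conductorNorm ℤ)),
        IsIsogenous W W₀ ∧ ¬ (p : ℤ) ∣ D₀.c := by
  sorry

/-- **The composition (no sorry of its own): the two stubs BY NAME ⟹ `ManinFrameResidueProper`.**
From the member datum with `p ∤ c₀` (stub of the prime range): a datum of `W` itself at level `N(W)`
with `p ∤ c` (`ManinFrameTransport.exists_modularParametrizationData_not_dvd_of_partner`, Irr), then
the Hoffstein–Luo odd Heegner frame (`ManinFrameFromDatum.exists_oddHeegnerFrame_of_exists_not_dvd`,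
modularity = conjunct 6 and Hoffstein–Luo = conjunct 7 of `PublishedInputsAdditiveKoly`). -/
theorem ManinFrameResidueProper_of :
    Summit.BirchSwinnertonDyer.BirchSwinnertonDyer.Theses.AdditiveKolyvaginRoad.ManinFrameResidueProper := by
  intro hPub W _ _ p hp _ hp5 hadd hirr hres hall hr
  -- a member with a Manin-unit datum, by prime range (the two stubs, by name)
  have hmem : ∃ (W₀ : WeierstrassCurve ℚ) (_ : W₀.IsElliptic) (_ : W₀.IsGloballyMinimal)
      (D₀ : ModularParametrizationData W₀ (W.conductorNorm ℤ)),
      IsIsogenous W W₀ ∧ ¬ (p : ℤ) ∣ D₀.c := by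
    rcases lt_or_ge p 11 with h11 | h11
    · exact stub_memberManinUnit_fiveSeven hPub.2.2.2.2.2.1 W p hp5 h11 hadd hirr hres hall
    · exact stub_memberManinUnit_ordinary hPub.2.2.2.2.2.1 W p h11 hadd hirr hres hall
  obtain ⟨W₀, hE₀, hM₀, D₀, hiso, hc₀⟩ := hmem
  haveI := hE₀
  haveI := hM₀
  -- transport to a datum of `W` with `p ∤ c` (prime-to-`p` isogeny multiplier under Irr)
  obtain ⟨Dt, hc⟩ :=
    Summit.BirchSwinnertonDyer.BirchSwinnertonDyer.Theorems.ManinFrameTransport.exists_modularParametrizationData_not_dvd_of_partner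
      W hp.out hirr hiso D₀ hc₀
  -- the Hoffstein–Luo odd Heegner frame
  have hp2 : p ≠ 2 := by omega
  exact Summit.BirchSwinnertonDyer.BirchSwinnertonDyer.Theorems.ManinFrameFromDatum.exists_oddHeegnerFrame_of_exists_not_dvd
    hPub.2.2.2.2.2.1
    hPub.2.2.2.2.2.2.1 W p hr hp2 ⟨Dt, hc⟩

end Summit.BirchSwinnertonDyer.BirchSwinnertonDyer.Cruxes.ManinFrameResidueProper.Birth

end
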